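import Mathlib.Algebra.QuaternionBasis
import Mathlib.FieldTheory.Finite.Basic
import Mathlib.LinearAlgebra.Projectivization.Action
import Mathlib.LinearAlgebra.Projectivization.Cardinality
import Mathlib.RingTheory.Ideal.Norm.AbsNorm
import Literature.NumberTheory.Automorphic.QuaternionCoordOrder
import Literature.NumberTheory.GaloisRepresentations.SerreSubgroupsGL2Fp
import HarnessLib

/-!
# Hecke double cosets of prime level for `Γ = O^×`: reduction to strong approximation modulo `v`

Topic `NumberTheory/Automorphic`; companion ("proofs") file of `QuaternionCoordOrder` for its
named fact `QuaternionAlgebra.coordOrder_heckeDoubleCoset` (Hecke double cosets `Γ g Γ`,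
`g ḡ = ϖ`, for the unit group `Γ = O^×` of the coordinate order `O = 𝓞_K⟨1,i,j,k⟩` of
`ℍ[K,a,b]` at a principal place `v = (ϖ) ∤ 2ab`). All declarations here are theorems and
auxiliary definitions (no named fact).

We PROVE the statement of the fact at a place `v` **from strong approximation modulo `v` for the
norm-one group `O¹`**, i.e. from the hypothesis

  `(SA_v)  ∀ y ∈ O, y ȳ ≡ 1 (mod v O) → ∃ u ∈ O¹, u ≡ y (mod v O)`

("`O¹ → SL₂(𝓞_K / v)` is onto"), which is the shadow modulo `v` of Kneser's strong approximation
theorem for `H¹` (Vignéras, LNM 800, Ch. III §4 Thm. 4.3: `H¹_K H¹_S` is dense in `H¹_A` as soon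
as `H¹_S` is not compact — here `S = ∞` and `ℍ[K,a,b]` not totally definite) combined with Hensel's
lemma in `O_v ≅ M₂(𝓞_v)`; that theorem is not yet in the tree, and it is the only non-elementary
input: `coordOrder_heckeDoubleCoset_of_forall_normOne_lift` states precisely
`(∀ K a b v …, SA_v) → coordOrder_heckeDoubleCoset`.

## The argument (reduction modulo `v`; elementary)

Let `R → F` be a surjection onto a field (`F = 𝓞_K / v`) with kernel `𝔭 = (ϖ)`, `2ab ∉ 𝔭`.

* `intModelEquiv` : the coordinate order *is* the quaternion ring `ℍ[R,a,b]` over `R`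
  (Mathlib's `QuaternionAlgebra R a 0 b`), embedded coordinatewise (Vignéras III §5 A, the order
  `ℤ[1,i,j,ij]`).
* `matBasis`, `redHom` : with `s² - a t² = b` in `F` (solvable over a finite field of odd
  cardinality, `FiniteField.exists_root_sum_quadratic`) the matrices `I = (0 a; 1 0)`,
  `J = (s, -a t; t, -s)` form a quaternionic basis of `M₂(F)` of type `(a, b)` (Vignéras I §2
  Cor. 2.4, II §1 Lemme 1.10; the same matrices as in `QuaternionAlgebraIntegralSplitting`), whence
  the reduction map `φ : O → M₂(F)`, an `R`-algebra map with kernel `𝔭 O` (`redHom_eq_zero_iff`,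
  this uses `2ab ∉ 𝔭`), onto (`redHom_surjective`), with `φ(x̄) = adj φ(x)` (`redHom_star`).
* (ii) For `g ∈ O`, `g ḡ = ϖ`: `A = φ(g) ≠ 0`, `B = φ(ḡ) ≠ 0`, `A B = 0`, so `Im B = ker A` is a
  line `ℓ ∈ ℙ¹(F)` and `Γ ∩ g⁻¹ Γ g = {γ ∈ Γ : g γ ḡ ∈ ϖ O} = {γ : A φ(γ) B = 0}` is the stabiliser
  of `ℓ` for the action of `Γ` on `ℙ¹(F)` through `φ` (`subgroupOf_conj_unitGroup_eq_comap_stabilizer`).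
  Given `SA_v` the image of `Γ` contains `SL₂(F)`, which is transitive on `ℙ¹(F)` (Mathlib), so
  `[Γ : Γ ∩ g⁻¹ Γ g] = #ℙ¹(F) = q + 1` (orbit–stabiliser; Shimura 1971 Prop. 3.1 for the equality
  with the number of right cosets in `Γ g Γ`).
* (i) `x ∈ Γ g Γ ⇔ ∃ γ ∈ Γ, ḡ γ⁻¹ x ∈ ϖ O` (then `γ' = g⁻¹ γ⁻¹ x ∈ Γ` by Vignéras I Lemme 4.12,
  `mem_unitGroup_iff_exists_reducedNorm_eq`), and such a `γ` exists by transitivity as soon as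
  `x ∈ O` and `x x̄ ∈ R^× ϖ` (`φ(x)` is then non-zero of rank one). The inclusion `Γ g Γ ⊆ {…}` is
  multiplicativity of the reduced norm.

Main statements: `doubleCoset_unitGroup_eq_of_normOne_lift`, `relIndex_conj_unitGroup_eq_of_normOne_lift`
(over any `R ⊆ K` with a surjection `R → F` onto a finite field, kernel `(ϖ)`),
`coordOrder_heckeDoubleCoset_of_normOne_lift` (the number-field statement at one place `v`, from
`SA_v`) and `coordOrder_heckeDoubleCoset_of_forall_normOne_lift`.

## References

* M.-F. Vignéras, *Arithmétique des algèbres de quaternions*, LNM 800 (1980): Ch. I §2 Cor. 2.4,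
  §4 Lemme 4.12; Ch. II §1 Lemme 1.10, §2 Thm. 2.3; Ch. III §4 Thm. 4.3 (Kneser), §5 A
  [VignerasLNM800].
* G. Shimura, *Introduction to the arithmetic theory of automorphic functions* (1971), §3.1,
  Prop. 3.1 [Shimura1971].
-/

noncomputable section

open scoped Quaternion Pointwise MatrixGroups Matrix
open NumberField IsDedekindDomain

namespace Literature.NumberTheory.Automorphic

namespace QuaternionAlgebra

/-- `ℍ⟮K; R; a, b⟯ := ℍ[K, algebraMap R K a, algebraMap R K b]` (file-local notation, as in
`QuaternionCoordOrder`). -/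
local notation "ℍ⟮" K "; " R "; " a ", " b "⟯" =>
  QuaternionAlgebra K (algebraMap R K a) (0 : K) (algebraMap R K b)

/-! ### The integral model `ℍ[R,a,b] ≅ O` -/

section IntModel

variable {R : Type*} (K : Type*) [CommRing R] [CommRing K] [Algebra R K] (a b : R)

/-- The elements `i, j, k = ij` of `ℍ[K,a,b]` form a quaternionic basis of type `(a, 0, b)` of
`ℍ[K,a,b]` viewed as an `R`-algebra (`a, b ∈ R`). [folklore] -/
def intBasis : _root_.QuaternionAlgebra.Basis ℍ⟮K; R; a, b⟯ a 0 b where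
  i := ⟨0, 1, 0, 0⟩
  j := ⟨0, 0, 1, 0⟩
  k := ⟨0, 0, 0, 1⟩
  i_mul_i := by ext <;> simp [Algebra.smul_def]
  j_mul_j := by ext <;> simp [Algebra.smul_def]
  i_mul_j := by ext <;> simp
  j_mul_i := by ext <;> simp

/-- The **integral model** `ι : ℍ[R,a,b] →ₐ[R] ℍ[K,a,b]` of the coordinate order: Mathlib's
quaternion ring `ℍ[R,a,b]` over the commutative ring `R`, mapped coordinatewise by
`algebraMap R K` (the `R`-algebra map attached to `intBasis`). Its range is `O = R⟨1,i,j,k⟩`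
(`range_intModelHom`) and it is injective when `R → K` is, so that `O ≅ ℍ[R,a,b]`
(`intModelEquiv`): the coordinate order is the quaternion ring `R[i, j]`, `i² = a`, `j² = b`
(Vignéras III §5 A, the order `ℤ[1,i,j,ij]`). [cite: VignerasLNM800, Ch. III §5 A (example p. 85)] -/
def intModelHom : ℍ[R,a,b] →ₐ[R] ℍ⟮K; R; a, b⟯ :=
  (intBasis K a b).liftHom

/-- `ι ⟨r₀, r₁, r₂, r₃⟩ = r₀ + r₁ i + r₂ j + r₃ k`. [folklore] -/
@[simp]
theorem intModelHom_apply (y : ℍ[R,a,b]) :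
    intModelHom K a b y =
      ⟨algebraMap R K y.re, algebraMap R K y.imI, algebraMap R K y.imJ, algebraMap R K y.imK⟩ := by
  ext <;> simp [intModelHom, intBasis, _root_.QuaternionAlgebra.Basis.lift, Algebra.smul_def]

/-- `ι(ℍ[R,a,b]) ⊆ O`. [folklore] -/
theorem intModelHom_mem (y : ℍ[R,a,b]) : intModelHom K a b y ∈ coordOrder K a b := by
  rw [intModelHom_apply]
  exact mk_mem_coordOrder K a b _ _ _ _

/-- Every element of `O` is in the image of the integral model. [folklore] -/
theorem exists_intModelHom_eq_of_mem {x : ℍ⟮K; R; a, b⟯} (hx : x ∈ coordOrder K a b) :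
    ∃ y : ℍ[R,a,b], intModelHom K a b y = x := by
  obtain ⟨r₀, r₁, r₂, r₃, rfl⟩ := mem_coordOrder_iff_exists.mp hx
  exact ⟨⟨r₀, r₁, r₂, r₃⟩, intModelHom_apply K a b _⟩

/-- The range of the integral model is the coordinate order `O`.
[cite: VignerasLNM800, Ch. III §5 A (example p. 85)] -/
theorem range_intModelHom : (intModelHom K a b).range = coordOrder K a b := by
  ext x
  rw [AlgHom.mem_range]
  exact ⟨fun ⟨y, hy⟩ => hy ▸ intModelHom_mem K a b y, exists_intModelHom_eq_of_mem K a b⟩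

/-- The integral model commutes with conjugation. [folklore] -/
theorem intModelHom_star (y : ℍ[R,a,b]) :
    intModelHom K a b (star y) = star (intModelHom K a b y) := by
  ext <;> simp

/-- The integral model on scalars. [folklore] -/
theorem intModelHom_coe (r : R) :
    intModelHom K a b (r : ℍ[R,a,b]) = algebraMap K ℍ⟮K; R; a, b⟯ (algebraMap R K r) := by
  rw [_root_.QuaternionAlgebra.algebraMap_eq]
  ext <;> simp

/-- `ι(y) ι(y)‾ = n(y)` with `n(y) = r₀² - a r₁² - b r₂² + ab r₃² ∈ R`. [cite: VignerasLNM800, Ch. I §1 Lemme 1.1] -/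
theorem intModelHom_mul_star (y : ℍ[R,a,b]) :
    intModelHom K a b y * star (intModelHom K a b y) = algebraMap K ℍ⟮K; R; a, b⟯
      (algebraMap R K (y.re ^ 2 - a * y.imI ^ 2 - b * y.imJ ^ 2 + a * b * y.imK ^ 2)) := by
  rw [_root_.QuaternionAlgebra.algebraMap_eq, intModelHom_apply]
  ext <;> simp <;> ring

variable [FaithfulSMul R K]

/-- For `R → K` injective the integral model is injective. [folklore] -/
theorem intModelHom_injective : Function.Injective (intModelHom K a b) := by
  intro y₁ y₂ h
  have hinj := FaithfulSMul.algebraMap_injective R K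
  rw [intModelHom_apply, intModelHom_apply, _root_.QuaternionAlgebra.mk.injEq] at h
  ext
  exacts [hinj h.1, hinj h.2.1, hinj h.2.2.1, hinj h.2.2.2]

/-- **`O ≅ ℍ[R,a,b]`**: the coordinate order of `ℍ[K,a,b]` is the quaternion ring over `R` with the
same parameters (for `R → K` injective). [cite: VignerasLNM800, Ch. III §5 A (example p. 85)] -/
def intModelEquiv : ℍ[R,a,b] ≃ₐ[R] coordOrder K a b :=
  AlgEquiv.ofBijective ((intModelHom K a b).codRestrict (coordOrder K a b) (intModelHom_mem K a b))
    ⟨fun _ _ h => intModelHom_injective K a b (congrArg Subtype.val h),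
      fun x => (exists_intModelHom_eq_of_mem K a b x.2).imp fun _ hy => Subtype.ext hy⟩

/-- Unfolding of `intModelEquiv`. [folklore] -/
@[simp]
theorem coe_intModelEquiv (y : ℍ[R,a,b]) :
    ((intModelEquiv K a b y : coordOrder K a b) : ℍ⟮K; R; a, b⟯) = intModelHom K a b y :=
  rfl

/-- Unfolding of `intModelEquiv.symm`. [folklore] -/
@[simp]
theorem intModelHom_symm_apply (x : coordOrder K a b) :
    intModelHom K a b ((intModelEquiv K a b).symm x) = x := by
  rw [← coe_intModelEquiv, AlgEquiv.apply_symm_apply]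

/-- `⟨ι y, _⟩ = intModelEquiv y` in `O`. [folklore] -/
theorem mk_intModelHom (y : ℍ[R,a,b]) (h : intModelHom K a b y ∈ coordOrder K a b) :
    (⟨intModelHom K a b y, h⟩ : coordOrder K a b) = intModelEquiv K a b y :=
  rfl

end IntModel

/-! ### The matrix model `ℍ[R,a,b] → M₂(F)` over a residue field -/

section MatrixModel

variable {R : Type*} [CommRing R] (a b : R) {F : Type*} [Field F] [Algebra R F] (s t : F)

/-- For `s² - a t² = b` in `F`, the matrices `I = (0 a; 1 0)`, `J = (s, -a t; t, -s)`, `K = IJ`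
form a quaternionic basis of type `(a, 0, b)` of `M₂(F)` as an `R`-algebra (Vignéras I §2
Cor. 2.4: `{L, θ} ≅ M₂` when `θ` is a norm; II §1 Lemme 1.10). [cite: VignerasLNM800, Ch. I §2 Cor. 2.4] -/
def matBasis (hst : s ^ 2 - algebraMap R F a * t ^ 2 = algebraMap R F b) :
    _root_.QuaternionAlgebra.Basis (Matrix (Fin 2) (Fin 2) F) a 0 b where
  i := !![0, algebraMap R F a; 1, 0]
  j := !![s, -(algebraMap R F a * t); t, -s]
  k := !![0, algebraMap R F a; 1, 0] * !![s, -(algebraMap R F a * t); t, -s]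
  i_mul_i := by
    ext i j
    fin_cases i <;> fin_cases j <;>
      simp [Matrix.mul_apply, Fin.sum_univ_two, Algebra.smul_def, Matrix.algebraMap_matrix_apply]
  j_mul_j := by
    ext i j
    fin_cases i <;> fin_cases j <;>
      simp [Matrix.mul_apply, Fin.sum_univ_two, Algebra.smul_def] <;> (try rw [← hst]) <;> ring
  i_mul_j := rfl
  j_mul_i := by
    ext i j
    fin_cases i <;> fin_cases j <;>
      simp [Matrix.mul_apply, Fin.sum_univ_two, Algebra.smul_def] <;> ring

/-- The **matrix model** `ψ : ℍ[R,a,b] →ₐ[R] M₂(F)` attached to `matBasis` (reduction modulo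
`𝔭 = ker (R → F)` followed by the splitting `ℍ[F,a,b] ≅ M₂(F)`). [cite: VignerasLNM800, Ch. I §2 Cor. 2.4] -/
def matModelHom (hst : s ^ 2 - algebraMap R F a * t ^ 2 = algebraMap R F b) :
    ℍ[R,a,b] →ₐ[R] Matrix (Fin 2) (Fin 2) F :=
  (matBasis a b s t hst).liftHom

/-- The `F`-linear map `F⁴ → M₂(F)`, `c ↦ c₀ + c₁ I + c₂ J + c₃ IJ`, written out. [folklore] -/
def matModelLin : (Fin 4 → F) →ₗ[F] Matrix (Fin 2) (Fin 2) F where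
  toFun c := !![c 0 + c 2 * s + c 3 * (algebraMap R F a * t),
      c 1 * algebraMap R F a - c 2 * (algebraMap R F a * t) - c 3 * (algebraMap R F a * s);
    c 1 + c 2 * t + c 3 * s, c 0 - c 2 * s - c 3 * (algebraMap R F a * t)]
  map_add' c d := by
    ext i j
    fin_cases i <;> fin_cases j <;> simp <;> ring
  map_smul' c d := by
    ext i j
    fin_cases i <;> fin_cases j <;> simp <;> ring

/-- Unfolding of `matModelLin`. [folklore] -/
theorem matModelLin_apply (c : Fin 4 → F) :
    matModelLin a s t c = !![c 0 + c 2 * s + c 3 * (algebraMap R F a * t),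
      c 1 * algebraMap R F a - c 2 * (algebraMap R F a * t) - c 3 * (algebraMap R F a * s);
      c 1 + c 2 * t + c 3 * s, c 0 - c 2 * s - c 3 * (algebraMap R F a * t)] :=
  rfl

variable {a b s t}

/-- The matrix model in coordinates: `ψ(y) = r̄₀ + r̄₁ I + r̄₂ J + r̄₃ IJ`. [folklore] -/
theorem matModelHom_apply (hst : s ^ 2 - algebraMap R F a * t ^ 2 = algebraMap R F b)
    (y : ℍ[R,a,b]) :
    matModelHom a b s t hst y = matModelLin a s t
      ![algebraMap R F y.re, algebraMap R F y.imI, algebraMap R F y.imJ, algebraMap R F y.imK] := by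
  rw [matModelLin_apply]
  ext i j
  fin_cases i <;> fin_cases j <;>
    simp [matModelHom, matBasis, _root_.QuaternionAlgebra.Basis.lift, Matrix.mul_apply,
      Algebra.smul_def, Matrix.algebraMap_matrix_apply] <;> ring

/-- `ψ(ȳ) = adj ψ(y)`: the matrix model carries quaternion conjugation to the adjugate.
[cite: VignerasLNM800, Ch. I §1 (M(2,K), h̄ = adjoint)] -/
theorem matModelHom_star (hst : s ^ 2 - algebraMap R F a * t ^ 2 = algebraMap R F b)
    (y : ℍ[R,a,b]) :
    matModelHom a b s t hst (star y) = (matModelHom a b s t hst y).adjugate := by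
  rw [matModelHom_apply, matModelHom_apply, matModelLin_apply, matModelLin_apply,
    Matrix.adjugate_fin_two]
  ext i j
  fin_cases i <;> fin_cases j <;> simp <;> ring

/-- The span map `F⁴ → M₂(F)` of `1, I, J, IJ` is injective when `2 a b ≠ 0` in `F`
(the four matrices are linearly independent). [cite: VignerasLNM800, Ch. I §2 Cor. 2.4] -/
theorem matModelLin_injective (h2 : (2 : F) ≠ 0) (ha : algebraMap R F a ≠ 0)
    (hb : algebraMap R F b ≠ 0) (hst : s ^ 2 - algebraMap R F a * t ^ 2 = algebraMap R F b) :
    Function.Injective (matModelLin a s t) := by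
  rw [← LinearMap.ker_eq_bot, LinearMap.ker_eq_bot']
  intro c hc
  have h00 := congrFun (congrFun hc 0) 0
  have h01 := congrFun (congrFun hc 0) 1
  have h10 := congrFun (congrFun hc 1) 0
  have h11 := congrFun (congrFun hc 1) 1
  simp only [matModelLin_apply, Matrix.of_apply, Matrix.cons_val', Matrix.cons_val_zero,
    Matrix.cons_val_one, Matrix.cons_val_fin_one, Matrix.zero_apply] at h00 h01 h10 h11
  set α := algebraMap R F a with hα
  have hc1 : c 1 = 0 := by
    have h : (2 * α) * c 1 = 0 := by linear_combination h01 + α * h10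
    exact (mul_eq_zero.mp h).resolve_left (mul_ne_zero h2 ha)
  have hc0 : c 0 = 0 := by
    have h : 2 * c 0 = 0 := by linear_combination h00 + h11
    exact (mul_eq_zero.mp h).resolve_left h2
  have E1 : c 2 * t + c 3 * s = 0 := by linear_combination h10 - hc1
  have E2 : c 2 * s + c 3 * (α * t) = 0 := by linear_combination h00 - hc0
  have hc3 : c 3 = 0 := by
    have h : c 3 * (s ^ 2 - α * t ^ 2) = 0 := by linear_combination s * E1 - t * E2
    rw [hst] at h
    exact (mul_eq_zero.mp h).resolve_right hb
  have hc2 : c 2 = 0 := by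
    by_contra h
    have ht : t = 0 := by
      have h' : c 2 * t = 0 := by linear_combination E1 - s * hc3
      exact (mul_eq_zero.mp h').resolve_left h
    have hs : s = 0 := by
      have h' : c 2 * s = 0 := by linear_combination E2 - (α * t) * hc3
      exact (mul_eq_zero.mp h').resolve_left h
    apply hb
    rw [← hst, hs, ht]
    ring
  ext n
  fin_cases n
  exacts [hc0, hc1, hc2, hc3]

/-- … hence onto `M₂(F)` (dimension `4` on both sides). [cite: VignerasLNM800, Ch. I §2 Cor. 2.4] -/
theorem matModelLin_surjective (h2 : (2 : F) ≠ 0) (ha : algebraMap R F a ≠ 0)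
    (hb : algebraMap R F b ≠ 0) (hst : s ^ 2 - algebraMap R F a * t ^ 2 = algebraMap R F b) :
    Function.Surjective (matModelLin a s t) := by
  refine (LinearMap.injective_iff_surjective_of_finrank_eq_finrank ?_).mp
    (matModelLin_injective h2 ha hb hst)
  rw [Module.finrank_fin_fun, Module.finrank_matrix, Fintype.card_fin]
  norm_num

/-- The matrix model `ψ : ℍ[R,a,b] → M₂(F)` is onto when `R → F` is (`2ab ≠ 0` in `F`).
[cite: VignerasLNM800, Ch. I §2 Cor. 2.4] -/
theorem matModelHom_surjective (hπ : Function.Surjective (algebraMap R F)) (h2 : (2 : F) ≠ 0)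
    (ha : algebraMap R F a ≠ 0) (hb : algebraMap R F b ≠ 0)
    (hst : s ^ 2 - algebraMap R F a * t ^ 2 = algebraMap R F b) :
    Function.Surjective (matModelHom a b s t hst) := by
  intro M
  obtain ⟨c, rfl⟩ := matModelLin_surjective h2 ha hb hst M
  choose r hr using fun n => hπ (c n)
  refine ⟨⟨r 0, r 1, r 2, r 3⟩, ?_⟩
  rw [matModelHom_apply]
  congr 1
  ext n
  fin_cases n <;> simp [hr]

/-- The kernel of the matrix model: `ψ(y) = 0` iff all four coordinates of `y` die in `F`
(`2ab ≠ 0` in `F`). [cite: VignerasLNM800, Ch. I §2 Cor. 2.4] -/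
theorem matModelHom_eq_zero_iff (h2 : (2 : F) ≠ 0) (ha : algebraMap R F a ≠ 0)
    (hb : algebraMap R F b ≠ 0) (hst : s ^ 2 - algebraMap R F a * t ^ 2 = algebraMap R F b)
    (y : ℍ[R,a,b]) :
    matModelHom a b s t hst y = 0 ↔ algebraMap R F y.re = 0 ∧ algebraMap R F y.imI = 0 ∧
      algebraMap R F y.imJ = 0 ∧ algebraMap R F y.imK = 0 := by
  rw [matModelHom_apply]
  constructor
  · intro h
    have h0 := matModelLin_injective h2 ha hb hst (h.trans (map_zero _).symm)
    exact ⟨congrFun h0 0, congrFun h0 1, congrFun h0 2, congrFun h0 3⟩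
  · rintro ⟨h₀, h₁, h₂, h₃⟩
    rw [← map_zero (matModelLin a s t)]
    congr 1
    ext n
    fin_cases n
    exacts [h₀, h₁, h₂, h₃]

end MatrixModel

/-! ### Two-by-two linear algebra over a field

The kernel of a non-zero `2 × 2` matrix is at most a line: this is the tree's
`Serre1972.exists_eq_smul_of_mulVec_eq_zero` (`SerreSubgroupsGL2Fp`), reused here. -/

section LinAlg

variable {F : Type*} [Field F]

/-- A non-zero matrix has a non-zero column. [folklore] -/
theorem exists_col_ne_zero {A : Matrix (Fin 2) (Fin 2) F} (hA : A ≠ 0) : ∃ j, A.col j ≠ 0 := by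
  by_contra h
  push Not at h
  exact hA (Matrix.ext fun i j => congrFun (h j) i)

/-- Columns of a product: `(A B)_j = A B_j`. [folklore] -/
theorem col_mul_eq_mulVec (A B : Matrix (Fin 2) (Fin 2) F) (j : Fin 2) :
    (A * B).col j = A *ᵥ B.col j := by
  rw [← Matrix.mulVec_single_one, ← Matrix.mulVec_mulVec, Matrix.mulVec_single_one]

/-- For non-zero `A, B ∈ M₂(F)` with `A B = 0` and `w = B_j` a non-zero column of `B` (so that
`F w = Im B = ker A`): `A P B = 0 ↔ P w ∈ F w`. [folklore] -/
theorem mul_mul_eq_zero_iff_exists_mulVec_col_eq_smul {A B : Matrix (Fin 2) (Fin 2) F} (hA : A ≠ 0)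
    (hAB : A * B = 0) {j : Fin 2} (hw : B.col j ≠ 0) (P : Matrix (Fin 2) (Fin 2) F) :
    A * P * B = 0 ↔ ∃ c : F, P *ᵥ B.col j = c • B.col j := by
  have hcol : ∀ j', A *ᵥ B.col j' = 0 := fun j' => by
    rw [← col_mul_eq_mulVec, hAB]
    rfl
  constructor
  · intro h
    refine GaloisRepresentations.Serre1972.exists_eq_smul_of_mulVec_eq_zero hA hw (hcol j) ?_
    rw [Matrix.mulVec_mulVec, ← col_mul_eq_mulVec, h]
    rfl
  · rintro ⟨c, hc⟩
    ext i j'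
    obtain ⟨c', hc'⟩ :=
      GaloisRepresentations.Serre1972.exists_eq_smul_of_mulVec_eq_zero hA hw (hcol j) (hcol j')
    have h : (A * P * B).col j' = 0 := by
      rw [col_mul_eq_mulVec, hc', Matrix.mulVec_smul, ← Matrix.mulVec_mulVec, hc,
        Matrix.mulVec_smul, hcol j, smul_zero, smul_zero]
    exact congrFun h i

/-- For `B A = 0`, `D C = 0` with `D ≠ 0`, `w₂ = C_{j₂} ≠ 0` (so the columns of `C` span the line
`F w₂ ⊆ ker D`) and `Q P = 1`: if `P` maps the column `A_{j₁}` (killed by `B`) to the line `F w₂`,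
then `B Q C = 0`. [folklore] -/
theorem mul_mul_eq_zero_of_smul_col_eq_mulVec_col {A B C D P Q : Matrix (Fin 2) (Fin 2) F}
    (hBA : B * A = 0) (hD : D ≠ 0) (hDC : D * C = 0) {j₁ j₂ : Fin 2} (hw₂ : C.col j₂ ≠ 0)
    (hQP : Q * P = 1) {c : F} (hc0 : c ≠ 0) (hc : c • C.col j₂ = P *ᵥ A.col j₁) :
    B * Q * C = 0 := by
  have hBw₁ : B *ᵥ A.col j₁ = 0 := by
    rw [← col_mul_eq_mulVec, hBA]
    rfl
  have hDcol : ∀ j', D *ᵥ C.col j' = 0 := fun j' => by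
    rw [← col_mul_eq_mulVec, hDC]
    rfl
  have hQ : Q *ᵥ C.col j₂ = c⁻¹ • A.col j₁ := by
    rw [eq_inv_smul_iff₀ hc0, ← Matrix.mulVec_smul, hc, Matrix.mulVec_mulVec, hQP,
      Matrix.one_mulVec]
  ext i j'
  obtain ⟨c', hc'⟩ :=
    GaloisRepresentations.Serre1972.exists_eq_smul_of_mulVec_eq_zero hD hw₂ (hDcol j₂) (hDcol j')
  have h : (B * Q * C).col j' = 0 := by
    rw [col_mul_eq_mulVec, hc', Matrix.mulVec_smul, ← Matrix.mulVec_mulVec, hQ,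
      Matrix.mulVec_smul, hBw₁, smul_zero, smul_zero]
  exact congrFun h i

/-- `P ∈ GL₂(F)` fixes the point `[w] ∈ ℙ¹(F)` iff `P w ∈ F w`. [folklore] -/
theorem smul_mk_eq_self_iff {P : GL (Fin 2) F} {w : Fin 2 → F} (hw : w ≠ 0) :
    P • Projectivization.mk F w hw = Projectivization.mk F w hw ↔
      ∃ c : F, (P : Matrix (Fin 2) (Fin 2) F) *ᵥ w = c • w := by
  rw [Projectivization.smul_mk, Projectivization.mk_eq_mk_iff']
  exact ⟨fun ⟨c, hc⟩ => ⟨c, hc.symm⟩, fun ⟨c, hc⟩ => ⟨c, hc.symm⟩⟩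

/-- The stabiliser of a point of `ℙ¹(F)` inside a subgroup of `GL₂(F)` is the trace of the
stabiliser. [folklore] -/
theorem stabilizer_subgroup_eq_subgroupOf (H : Subgroup (GL (Fin 2) F))
    (m : Projectivization F (Fin 2 → F)) :
    MulAction.stabilizer H m = (MulAction.stabilizer (GL (Fin 2) F) m).subgroupOf H := by
  ext P
  rw [MulAction.mem_stabilizer_iff, Subgroup.mem_subgroupOf, MulAction.mem_stabilizer_iff]
  rfl

end LinAlg

/-! ### Reduction of the coordinate order modulo `𝔭 = ker (R → F)` -/

section Reduction

variable {R : Type*} (K : Type*) [CommRing R] [Field K] [Algebra R K] [FaithfulSMul R K]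
  (a b : R) {F : Type*} [Field F] [Algebra R F] (s t : F)
  (hst : s ^ 2 - algebraMap R F a * t ^ 2 = algebraMap R F b)

/-- The **reduction map `φ : O → M₂(F)`** of the coordinate order modulo `𝔭 = ker (R → F)`:
`O ≅ ℍ[R,a,b] → ℍ[F,a,b] ≅ M₂(F)` (`matModelHom ∘ intModelEquiv⁻¹`). For `F = 𝓞_K / v`,
`v ∤ 2ab`, this is the reduction `O → O / vO ≅ O_v / ϖ O_v ≅ M₂(𝔽_v)` of the maximal order
`O_v ≅ M₂(R_v)` (Vignéras II §1–§2). [cite: VignerasLNM800, Ch. I §2 Cor. 2.4 and Ch. II §2] -/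
def redHom : coordOrder K a b →ₐ[R] Matrix (Fin 2) (Fin 2) F :=
  (matModelHom a b s t hst).comp ((intModelEquiv K a b).symm : coordOrder K a b →ₐ[R] ℍ[R,a,b])

variable {K a b s t}

/-- `φ(ι y) = ψ(y)`. [folklore] -/
theorem redHom_mk_intModelHom (y : ℍ[R,a,b]) (h : intModelHom K a b y ∈ coordOrder K a b) :
    redHom K a b s t hst ⟨intModelHom K a b y, h⟩ = matModelHom a b s t hst y := by
  rw [mk_intModelHom, redHom, AlgHom.comp_apply, AlgEquiv.coe_toAlgHom, AlgEquiv.symm_apply_apply]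

/-- `φ` is multiplicative (packaged for subtype elements). [folklore] -/
theorem redHom_mul {x y : ℍ⟮K; R; a, b⟯} (hx : x ∈ coordOrder K a b) (hy : y ∈ coordOrder K a b) :
    redHom K a b s t hst ⟨x * y, mul_mem hx hy⟩ =
      redHom K a b s t hst ⟨x, hx⟩ * redHom K a b s t hst ⟨y, hy⟩ := by
  rw [← map_mul]
  rfl

/-- `φ(x̄) = adj φ(x)`. [cite: VignerasLNM800, Ch. I §1 (M(2,K), h̄ = adjoint)] -/
theorem redHom_star {x : ℍ⟮K; R; a, b⟯} (hx : x ∈ coordOrder K a b) :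
    redHom K a b s t hst ⟨star x, star_mem_coordOrder hx⟩ =
      (redHom K a b s t hst ⟨x, hx⟩).adjugate := by
  obtain ⟨y, rfl⟩ := exists_intModelHom_eq_of_mem K a b hx
  have h : (⟨star (intModelHom K a b y), star_mem_coordOrder hx⟩ : coordOrder K a b) =
      ⟨intModelHom K a b (star y), intModelHom_mem K a b _⟩ :=
    Subtype.ext (intModelHom_star K a b y).symm
  rw [h, redHom_mk_intModelHom, redHom_mk_intModelHom, matModelHom_star]

/-- `φ` on scalars `r ∈ R`: the scalar matrix `r̄`. [folklore] -/
theorem redHom_algebraMap (r : R)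
    (h : algebraMap K ℍ⟮K; R; a, b⟯ (algebraMap R K r) ∈ coordOrder K a b) :
    redHom K a b s t hst ⟨algebraMap K ℍ⟮K; R; a, b⟯ (algebraMap R K r), h⟩ =
      algebraMap F (Matrix (Fin 2) (Fin 2) F) (algebraMap R F r) := by
  have h' : (⟨algebraMap K ℍ⟮K; R; a, b⟯ (algebraMap R K r), h⟩ : coordOrder K a b) =
      algebraMap R (coordOrder K a b) r :=
    Subtype.ext (IsScalarTower.algebraMap_apply R K ℍ⟮K; R; a, b⟯ r).symm
  rw [h', AlgHom.commutes, IsScalarTower.algebraMap_apply R F (Matrix (Fin 2) (Fin 2) F)]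

/-- **Kernel of the reduction map**: `φ(x) = 0 ↔ x ∈ 𝔭 O`, `𝔭 = ker (R → F)` (uses `2ab ∉ 𝔭`).
[cite: VignerasLNM800, Ch. I §2 Cor. 2.4] -/
theorem redHom_eq_zero_iff (h2 : (2 : F) ≠ 0) (ha : algebraMap R F a ≠ 0)
    (hb : algebraMap R F b ≠ 0) {x : ℍ⟮K; R; a, b⟯} (hx : x ∈ coordOrder K a b) :
    redHom K a b s t hst ⟨x, hx⟩ = 0 ↔
      x ∈ idealLattice K a b (RingHom.ker (algebraMap R F)) := by
  obtain ⟨y, rfl⟩ := exists_intModelHom_eq_of_mem K a b hx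
  rw [redHom_mk_intModelHom, matModelHom_eq_zero_iff h2 ha hb hst, mem_idealLattice_iff_exists]
  constructor
  · rintro ⟨h₀, h₁, h₂, h₃⟩
    exact ⟨y.re, h₀, y.imI, h₁, y.imJ, h₂, y.imK, h₃, intModelHom_apply K a b y⟩
  · rintro ⟨r₀, hr₀, r₁, hr₁, r₂, hr₂, r₃, hr₃, h⟩
    have hy : y = ⟨r₀, r₁, r₂, r₃⟩ :=
      intModelHom_injective K a b (by rw [h, intModelHom_apply])
    subst hy
    exact ⟨hr₀, hr₁, hr₂, hr₃⟩

/-- Two elements of `O` congruent modulo `𝔭 O` have the same reduction. [folklore] -/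
theorem redHom_eq_of_sub_mem (h2 : (2 : F) ≠ 0) (ha : algebraMap R F a ≠ 0)
    (hb : algebraMap R F b ≠ 0) {x y : ℍ⟮K; R; a, b⟯} (hx : x ∈ coordOrder K a b)
    (hy : y ∈ coordOrder K a b)
    (hxy : x - y ∈ idealLattice K a b (RingHom.ker (algebraMap R F))) :
    redHom K a b s t hst ⟨x, hx⟩ = redHom K a b s t hst ⟨y, hy⟩ := by
  have h : (⟨x, hx⟩ : coordOrder K a b) = ⟨x - y, sub_mem hx hy⟩ + ⟨y, hy⟩ :=
    Subtype.ext (sub_add_cancel x y).symm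
  rw [h, map_add, (redHom_eq_zero_iff hst h2 ha hb (sub_mem hx hy)).mpr hxy, zero_add]

/-- **The reduction map is onto `M₂(F)`** (when `R → F` is onto and `2ab ∉ 𝔭`).
[cite: VignerasLNM800, Ch. I §2 Cor. 2.4] -/
theorem redHom_surjective (hπ : Function.Surjective (algebraMap R F)) (h2 : (2 : F) ≠ 0)
    (ha : algebraMap R F a ≠ 0) (hb : algebraMap R F b ≠ 0) :
    Function.Surjective (redHom K a b s t hst) := by
  intro M
  obtain ⟨y, hy⟩ := matModelHom_surjective hπ h2 ha hb hst M
  exact ⟨intModelEquiv K a b y, by rw [← mk_intModelHom K a b y (intModelHom_mem K a b y),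
    redHom_mk_intModelHom, hy]⟩

/-! #### Multiples of `ϖ` -/

omit [FaithfulSMul R K] in
/-- `x ∈ (ϖ) O ↔ x = ϖ z` with `z ∈ O`. [folklore] -/
theorem mem_idealLattice_span_singleton_iff (ϖ : R) {x : ℍ⟮K; R; a, b⟯} :
    x ∈ idealLattice K a b (Ideal.span {ϖ}) ↔
      ∃ z ∈ coordOrder K a b, x = algebraMap R K ϖ • z := by
  rw [mem_idealLattice_iff_exists]
  constructor
  · rintro ⟨r₀, hr₀, r₁, hr₁, r₂, hr₂, r₃, hr₃, rfl⟩
    obtain ⟨y₀, rfl⟩ := Ideal.mem_span_singleton'.mp hr₀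
    obtain ⟨y₁, rfl⟩ := Ideal.mem_span_singleton'.mp hr₁
    obtain ⟨y₂, rfl⟩ := Ideal.mem_span_singleton'.mp hr₂
    obtain ⟨y₃, rfl⟩ := Ideal.mem_span_singleton'.mp hr₃
    refine ⟨⟨algebraMap R K y₀, algebraMap R K y₁, algebraMap R K y₂, algebraMap R K y₃⟩,
      mk_mem_coordOrder K a b _ _ _ _, ?_⟩
    ext <;> simp [mul_comm, Algebra.smul_def]
  · rintro ⟨z, hz, rfl⟩
    obtain ⟨y₀, y₁, y₂, y₃, rfl⟩ := mem_coordOrder_iff_exists.mp hz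
    refine ⟨ϖ * y₀, Ideal.mul_mem_right _ _ (Ideal.mem_span_singleton_self ϖ),
      ϖ * y₁, Ideal.mul_mem_right _ _ (Ideal.mem_span_singleton_self ϖ),
      ϖ * y₂, Ideal.mul_mem_right _ _ (Ideal.mem_span_singleton_self ϖ),
      ϖ * y₃, Ideal.mul_mem_right _ _ (Ideal.mem_span_singleton_self ϖ), ?_⟩
    ext <;> simp [Algebra.smul_def]

omit [FaithfulSMul R K] in
/-- `z z̄ ∈ R` (as a scalar of `ℍ[K,a,b]`) for `z ∈ O`. [cite: VignerasLNM800, Ch. I §4 Lemme 4.1] -/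
theorem exists_mul_star_eq_algebraMap {z : ℍ⟮K; R; a, b⟯} (hz : z ∈ coordOrder K a b) :
    ∃ r : R, z * star z = algebraMap K ℍ⟮K; R; a, b⟯ (algebraMap R K r) := by
  obtain ⟨y, rfl⟩ := exists_intModelHom_eq_of_mem K a b hz
  exact ⟨_, intModelHom_mul_star K a b y⟩

/-- An element `x` of `ℍ[K,a,b]` with `x x̄ = ε ϖ`, `ε ∈ R^×`, `ϖ ≠ 0` a non-unit, is not in
`ϖ O` (otherwise `ε ϖ ∈ ϖ² R`). [folklore] -/
theorem not_mem_idealLattice_span_singleton_of_mul_star_eq {ϖ : R} (hϖ : ¬ IsUnit ϖ)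
    (hϖ0 : ϖ ≠ 0) (ε : Rˣ) {x : ℍ⟮K; R; a, b⟯}
    (hxx : x * star x = algebraMap K ℍ⟮K; R; a, b⟯ (algebraMap R K ((ε : R) * ϖ))) :
    x ∉ idealLattice K a b (Ideal.span {ϖ}) := by
  intro hx
  obtain ⟨z, hz, rfl⟩ := (mem_idealLattice_span_singleton_iff ϖ).mp hx
  obtain ⟨r, hr⟩ := exists_mul_star_eq_algebraMap hz
  have hinj := FaithfulSMul.algebraMap_injective R K
  have hK : algebraMap R K ϖ ≠ 0 := fun h0 => hϖ0 (hinj (h0.trans (map_zero _).symm))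
  have h1 : algebraMap K ℍ⟮K; R; a, b⟯ (algebraMap R K ((ε : R) * ϖ)) =
      algebraMap K ℍ⟮K; R; a, b⟯ (algebraMap R K (ϖ * ϖ * r)) := by
    rw [← hxx, _root_.QuaternionAlgebra.star_smul, smul_mul_smul_comm, hr, Algebra.smul_def,
      ← map_mul, ← map_mul, ← map_mul]
  have h2 : algebraMap R K (ε : R) = algebraMap R K (ϖ * r) := by
    have h1' := _root_.QuaternionAlgebra.algebraMap_injective h1
    rw [map_mul, map_mul, map_mul] at h1'
    apply mul_right_cancel₀ hK
    rw [h1', map_mul]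
    ring
  exact hϖ (isUnit_of_mul_isUnit_left ((hinj h2) ▸ Units.isUnit ε))

/-! #### Elements of norm `ε ϖ` and the inverse of `g` -/

variable [NeZero (2 : K)]

omit [FaithfulSMul R K] in
/-- `x x̄ = n(x)` and `x x̄ = c` force `n(x) = c`. [cite: VignerasLNM800, Ch. I §1 Lemme 1.1] -/
theorem reducedNorm_eq_of_mul_star_eq {x : ℍ⟮K; R; a, b⟯} {c : K}
    (hxx : x * star x = algebraMap K ℍ⟮K; R; a, b⟯ c) : reducedNorm K _ x = c :=
  _root_.QuaternionAlgebra.algebraMap_injective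
    ((mul_star_self_eq_algebraMap_reducedNorm K x).symm.trans hxx)

omit [FaithfulSMul R K] [NeZero (2 : K)] in
/-- If `g ḡ = ϖ ≠ 0` then `g` is invertible with `g⁻¹ = ϖ⁻¹ ḡ`. [cite: VignerasLNM800, Ch. I §1 Lemme 1.1] -/
theorem units_inv_eq_smul_star {g : (ℍ⟮K; R; a, b⟯)ˣ} {c : K} (hc : c ≠ 0)
    (hgg : (g : ℍ⟮K; R; a, b⟯) * star (g : ℍ⟮K; R; a, b⟯) = algebraMap K ℍ⟮K; R; a, b⟯ c) :
    ((g⁻¹ : (ℍ⟮K; R; a, b⟯)ˣ) : ℍ⟮K; R; a, b⟯) = c⁻¹ • star (g : ℍ⟮K; R; a, b⟯) := by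
  refine Units.inv_eq_of_mul_eq_one_right ?_
  rw [mul_smul_comm, hgg, Algebra.smul_def, ← map_mul, inv_mul_cancel₀ hc, map_one]

omit [FaithfulSMul R K] [NeZero (2 : K)] in
/-- `ḡ g = g ḡ` (`= n(g)`). [folklore] -/
theorem star_mul_self_eq {x : ℍ⟮K; R; a, b⟯} {c : K}
    (hxx : x * star x = algebraMap K ℍ⟮K; R; a, b⟯ c) :
    star x * star (star x) = algebraMap K ℍ⟮K; R; a, b⟯ c := by
  rw [star_star, star_comm_self', hxx]

end Reduction

/-! ### The unit group acting on `ℙ¹(F)` through the reduction map -/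

section UnitsAction

variable {R : Type*} (K : Type*) [CommRing R] [Field K] [Algebra R K] [FaithfulSMul R K]
  (a b : R) {F : Type*} [Field F] [Algebra R F] (s t : F)
  (hst : s ^ 2 - algebraMap R F a * t ^ 2 = algebraMap R F b)

/-- The reduction map on units: `ρ : O^× →* GL₂(F)` (`Units.map` of `redHom` composed with
`O^× ≅ (O)ˣ`). [folklore] -/
def redUnitsHom : unitGroup K a b →* GL (Fin 2) F :=
  (Units.map (redHom K a b s t hst : coordOrder K a b →* Matrix (Fin 2) (Fin 2) F)).comp
    (unitGroupEquiv K a b).toMonoidHom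

variable {K a b s t}

/-- `ρ(u) = φ(u)` as matrices. [folklore] -/
@[simp]
theorem coe_redUnitsHom (u : unitGroup K a b) :
    ((redUnitsHom K a b s t hst u : GL (Fin 2) F) : Matrix (Fin 2) (Fin 2) F) =
      redHom K a b s t hst ⟨((u : (ℍ⟮K; R; a, b⟯)ˣ) : ℍ⟮K; R; a, b⟯), u.2.1⟩ :=
  rfl

/-- `ρ(u)⁻¹ = φ(u⁻¹)` as matrices. [folklore] -/
@[simp]
theorem coe_redUnitsHom_inv (u : unitGroup K a b) :
    (((redUnitsHom K a b s t hst u)⁻¹ : GL (Fin 2) F) : Matrix (Fin 2) (Fin 2) F) =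
      redHom K a b s t hst ⟨((u⁻¹ : (ℍ⟮K; R; a, b⟯)ˣ) : ℍ⟮K; R; a, b⟯), u.2.2⟩ :=
  rfl

/-- **Strong approximation modulo `𝔭` gives `SL₂(F) ⊆ ρ(O¹)`**: if every `y ∈ O` with
`y ȳ ≡ 1 (mod 𝔭O)` is congruent to a norm-one unit, then every `P ∈ SL₂(F)` is `ρ(u)` for some
`u ∈ O¹` (lift `P` to `y ∈ O` by surjectivity of `φ`; `φ(y ȳ) = P adj P = 1`).
[cite: VignerasLNM800, Ch. III §4 Thm. 4.3 (consequence mod 𝔭)] -/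
theorem exists_normOne_redUnitsHom_eq (hπ : Function.Surjective (algebraMap R F))
    (h2 : (2 : F) ≠ 0) (ha : algebraMap R F a ≠ 0) (hb : algebraMap R F b ≠ 0)
    (hSA : ∀ y ∈ coordOrder K a b,
      y * star y - 1 ∈ idealLattice K a b (RingHom.ker (algebraMap R F)) →
        ∃ u ∈ normOneGroup K a b,
          (u : ℍ⟮K; R; a, b⟯) - y ∈ idealLattice K a b (RingHom.ker (algebraMap R F)))
    (P : Matrix.SpecialLinearGroup (Fin 2) F) :
    ∃ u : unitGroup K a b, (u : (ℍ⟮K; R; a, b⟯)ˣ) ∈ normOneGroup K a b ∧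
      ((redUnitsHom K a b s t hst u : GL (Fin 2) F) : Matrix (Fin 2) (Fin 2) F) = P := by
  obtain ⟨⟨y, hy⟩, hyP⟩ := redHom_surjective (K := K) hst hπ h2 ha hb (P : Matrix (Fin 2) (Fin 2) F)
  have h1 : y * star y - 1 ∈ idealLattice K a b (RingHom.ker (algebraMap R F)) := by
    rw [← redHom_eq_zero_iff hst h2 ha hb
      (sub_mem (mul_mem hy (star_mem_coordOrder hy)) (one_mem _))]
    have h : (⟨y * star y - 1, sub_mem (mul_mem hy (star_mem_coordOrder hy)) (one_mem _)⟩ :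
        coordOrder K a b) = ⟨y, hy⟩ * ⟨star y, star_mem_coordOrder hy⟩ - 1 := rfl
    rw [h, map_sub, map_one, map_mul, redHom_star hst hy, hyP, Matrix.mul_adjugate, P.det_coe,
      one_smul, sub_self]
  obtain ⟨u, hu, huy⟩ := hSA y hy h1
  refine ⟨⟨u, normOneGroup_le_unitGroup K a b hu⟩, hu, ?_⟩
  rw [coe_redUnitsHom, ← hyP]
  exact redHom_eq_of_sub_mem hst h2 ha hb hu.1.1 hy huy

/-- Hence, under strong approximation modulo `𝔭`, `O^×` acts **transitively on `ℙ¹(F)`** through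
`ρ` (`SL₂(F)` does, Mathlib `Projectivization.specialLinearGroup_is_two_pretransitive`).
[cite: VignerasLNM800, Ch. III §4 Thm. 4.3 (consequence mod 𝔭)] -/
theorem exists_redUnitsHom_smul_eq (hπ : Function.Surjective (algebraMap R F))
    (h2 : (2 : F) ≠ 0) (ha : algebraMap R F a ≠ 0) (hb : algebraMap R F b ≠ 0)
    (hSA : ∀ y ∈ coordOrder K a b,
      y * star y - 1 ∈ idealLattice K a b (RingHom.ker (algebraMap R F)) →
        ∃ u ∈ normOneGroup K a b,
          (u : ℍ⟮K; R; a, b⟯) - y ∈ idealLattice K a b (RingHom.ker (algebraMap R F)))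
    (m₁ m₂ : Projectivization F (Fin 2 → F)) :
    ∃ u : unitGroup K a b, redUnitsHom K a b s t hst u • m₁ = m₂ := by
  obtain ⟨P, rfl⟩ := MulAction.exists_smul_eq (Matrix.SpecialLinearGroup (Fin 2) F) m₁ m₂
  obtain ⟨u, -, hu⟩ := exists_normOne_redUnitsHom_eq hst hπ h2 ha hb hSA P
  refine ⟨u, ?_⟩
  induction m₁ using Projectivization.ind with
  | h w hw =>
    rw [Projectivization.smul_mk, Projectivization.smul_mk]
    congr 1
    change ((redUnitsHom K a b s t hst u : GL (Fin 2) F) : Matrix (Fin 2) (Fin 2) F) *ᵥ w =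
      (P : Matrix (Fin 2) (Fin 2) F) *ᵥ w
    rw [hu]

/-- The image `ρ(O^×) ≤ GL₂(F)` acts transitively on `ℙ¹(F)` (under strong approximation
modulo `𝔭`). [cite: VignerasLNM800, Ch. III §4 Thm. 4.3 (consequence mod 𝔭)] -/
theorem isPretransitive_range_redUnitsHom (hπ : Function.Surjective (algebraMap R F))
    (h2 : (2 : F) ≠ 0) (ha : algebraMap R F a ≠ 0) (hb : algebraMap R F b ≠ 0)
    (hSA : ∀ y ∈ coordOrder K a b,
      y * star y - 1 ∈ idealLattice K a b (RingHom.ker (algebraMap R F)) →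
        ∃ u ∈ normOneGroup K a b,
          (u : ℍ⟮K; R; a, b⟯) - y ∈ idealLattice K a b (RingHom.ker (algebraMap R F))) :
    MulAction.IsPretransitive (redUnitsHom K a b s t hst).range
      (Projectivization F (Fin 2 → F)) :=
  ⟨fun m₁ m₂ => by
    obtain ⟨u, hu⟩ := exists_redUnitsHom_smul_eq hst hπ h2 ha hb hSA m₁ m₂
    exact ⟨⟨redUnitsHom K a b s t hst u, u, rfl⟩, hu⟩⟩

end UnitsAction

/-! ### The Hecke double coset `Γ g Γ` and the index `[Γ : Γ ∩ g⁻¹ Γ g]` -/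

section Hecke

variable {R : Type*} {K : Type*} [CommRing R] [Field K] [Algebra R K] [FaithfulSMul R K]
  {a b : R} {F : Type*} [Field F] [Algebra R F] {s t : F}
  (hst : s ^ 2 - algebraMap R F a * t ^ 2 = algebraMap R F b)
  (hπ : Function.Surjective (algebraMap R F))
  (h2 : (2 : F) ≠ 0) (ha : algebraMap R F a ≠ 0) (hb : algebraMap R F b ≠ 0)
  {ϖ : R} (hker : RingHom.ker (algebraMap R F) = Ideal.span {ϖ}) (hϖ0 : ϖ ≠ 0)
  {g : (ℍ⟮K; R; a, b⟯)ˣ} (hg : (g : ℍ⟮K; R; a, b⟯) ∈ coordOrder K a b)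
  (hgg : (g : ℍ⟮K; R; a, b⟯) * star (g : ℍ⟮K; R; a, b⟯) =
    algebraMap K ℍ⟮K; R; a, b⟯ (algebraMap R K ϖ))

include hker in
/-- `ϖ` is not a unit (the kernel of `R → F` is proper, `F` being a field). [folklore] -/
theorem not_isUnit_of_ker_eq : ¬ IsUnit ϖ := by
  intro h
  have h1 : (1 : R) ∈ RingHom.ker (algebraMap R F) := by
    rw [hker]
    exact Ideal.eq_top_of_isUnit_mem _ (Ideal.mem_span_singleton_self ϖ) h ▸ Submodule.mem_top
  rw [RingHom.mem_ker, map_one] at h1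
  exact one_ne_zero h1

include hker in
/-- `ϖ ↦ 0` in `F`. [folklore] -/
theorem algebraMap_eq_zero_of_ker_eq : algebraMap R F ϖ = 0 := by
  rw [← RingHom.mem_ker, hker]
  exact Ideal.mem_span_singleton_self ϖ

include h2 ha hb hker hϖ0 hgg in
/-- `φ(g) ≠ 0` for `g ḡ = ϖ` (`g ∉ ϖ O` since `ϖ ∉ ϖ² R`). [folklore] -/
theorem redHom_ne_zero_of_mul_star_eq : redHom K a b s t hst ⟨g, hg⟩ ≠ 0 := by
  rw [Ne, redHom_eq_zero_iff hst h2 ha hb hg, hker]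
  refine not_mem_idealLattice_span_singleton_of_mul_star_eq (not_isUnit_of_ker_eq hker) hϖ0 1 ?_
  rw [Units.val_one, one_mul, hgg]

include h2 ha hb hker hϖ0 hgg in
/-- `φ(ḡ) ≠ 0` likewise. [folklore] -/
theorem redHom_star_ne_zero_of_mul_star_eq :
    redHom K a b s t hst ⟨star (g : ℍ⟮K; R; a, b⟯), star_mem_coordOrder hg⟩ ≠ 0 := by
  rw [Ne, redHom_eq_zero_iff hst h2 ha hb (star_mem_coordOrder hg), hker]
  refine not_mem_idealLattice_span_singleton_of_mul_star_eq (not_isUnit_of_ker_eq hker) hϖ0 1 ?_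
  rw [Units.val_one, one_mul, star_mul_self_eq hgg]

include hker hgg in
/-- `φ(g) φ(ḡ) = φ(ϖ) = 0`. [folklore] -/
theorem redHom_mul_redHom_star_eq_zero :
    redHom K a b s t hst ⟨g, hg⟩ *
      redHom K a b s t hst ⟨star (g : ℍ⟮K; R; a, b⟯), star_mem_coordOrder hg⟩ = 0 := by
  rw [← redHom_mul]
  have h : (⟨(g : ℍ⟮K; R; a, b⟯) * star (g : ℍ⟮K; R; a, b⟯), mul_mem hg (star_mem_coordOrder hg)⟩ :
      coordOrder K a b) = ⟨algebraMap K ℍ⟮K; R; a, b⟯ (algebraMap R K ϖ),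
        hgg ▸ mul_mem hg (star_mem_coordOrder hg)⟩ := Subtype.ext hgg
  rw [h, redHom_algebraMap, algebraMap_eq_zero_of_ker_eq hker, map_zero]

include hker hgg in
/-- `φ(ḡ) φ(g) = 0`. [folklore] -/
theorem redHom_star_mul_redHom_eq_zero :
    redHom K a b s t hst ⟨star (g : ℍ⟮K; R; a, b⟯), star_mem_coordOrder hg⟩ *
      redHom K a b s t hst ⟨g, hg⟩ = 0 := by
  rw [← redHom_mul]
  have h : (⟨star (g : ℍ⟮K; R; a, b⟯) * (g : ℍ⟮K; R; a, b⟯), mul_mem (star_mem_coordOrder hg) hg⟩ :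
      coordOrder K a b) = ⟨algebraMap K ℍ⟮K; R; a, b⟯ (algebraMap R K ϖ),
        hgg ▸ mul_mem hg (star_mem_coordOrder hg)⟩ :=
    Subtype.ext ((star_comm_self' (g : ℍ⟮K; R; a, b⟯)).trans hgg)
  rw [h, redHom_algebraMap, algebraMap_eq_zero_of_ker_eq hker, map_zero]

variable [NeZero (2 : K)]

include h2 ha hb hker hϖ0 hgg in
/-- **`Γ ∩ g⁻¹ Γ g` through the reduction map**: for `γ ∈ Γ = O^×`,
`g γ g⁻¹ ∈ Γ ↔ φ(g) φ(γ) φ(ḡ) = 0` (i.e. `g γ ḡ ∈ ϖ O`; `⇐` uses Vignéras I Lemme 4.12,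
`n(g γ g⁻¹) = n(γ) ∈ R^×`). [cite: VignerasLNM800, Ch. I §4 Lemme 4.12] -/
theorem conj_mem_unitGroup_iff (γ : unitGroup K a b) :
    g * (γ : (ℍ⟮K; R; a, b⟯)ˣ) * g⁻¹ ∈ unitGroup K a b ↔
      redHom K a b s t hst ⟨g, hg⟩ *
        redHom K a b s t hst ⟨((γ : (ℍ⟮K; R; a, b⟯)ˣ) : ℍ⟮K; R; a, b⟯), γ.2.1⟩ *
        redHom K a b s t hst ⟨star (g : ℍ⟮K; R; a, b⟯), star_mem_coordOrder hg⟩ = 0 := by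
  have hinj := FaithfulSMul.algebraMap_injective R K
  have hK : algebraMap R K ϖ ≠ 0 := fun h0 => hϖ0 (hinj (h0.trans (map_zero _).symm))
  have hinv := units_inv_eq_smul_star hK hgg
  have hmem : (g : ℍ⟮K; R; a, b⟯) * (γ : (ℍ⟮K; R; a, b⟯)ˣ) * star (g : ℍ⟮K; R; a, b⟯) ∈
      coordOrder K a b := mul_mem (mul_mem hg γ.2.1) (star_mem_coordOrder hg)
  -- `↑(g γ g⁻¹) = ϖ⁻¹ (g γ ḡ)`
  have hconj : ((g * (γ : (ℍ⟮K; R; a, b⟯)ˣ) * g⁻¹ : (ℍ⟮K; R; a, b⟯)ˣ) : ℍ⟮K; R; a, b⟯) =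
      (algebraMap R K ϖ)⁻¹ • ((g : ℍ⟮K; R; a, b⟯) * (γ : (ℍ⟮K; R; a, b⟯)ˣ) *
        star (g : ℍ⟮K; R; a, b⟯)) := by
    rw [Units.val_mul, Units.val_mul, hinv, mul_smul_comm]
  rw [← redHom_mul, ← redHom_mul, redHom_eq_zero_iff hst h2 ha hb hmem, hker,
    mem_idealLattice_span_singleton_iff]
  constructor
  · intro h
    refine ⟨_, (mem_unitGroup_iff.mp h).1, ?_⟩
    rw [hconj, smul_smul, mul_inv_cancel₀ hK, one_smul]
  · rintro ⟨z, hz, hz'⟩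
    have hval : ((g * (γ : (ℍ⟮K; R; a, b⟯)ˣ) * g⁻¹ : (ℍ⟮K; R; a, b⟯)ˣ) : ℍ⟮K; R; a, b⟯) = z := by
      rw [hconj, hz', smul_smul, inv_mul_cancel₀ hK, one_smul]
    rw [mem_unitGroup_iff_exists_reducedNorm_eq, hval]
    refine ⟨hz, ?_⟩
    obtain ⟨r, hr⟩ := (mem_unitGroup_iff_exists_reducedNorm_eq.mp γ.2).2
    refine ⟨r, ?_⟩
    rw [← hval, Units.val_mul, Units.val_mul, reducedNorm_quaternionAlgebra_mul,
      reducedNorm_quaternionAlgebra_mul, mul_comm (reducedNorm K _ (g : ℍ⟮K; R; a, b⟯)), mul_assoc,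
      ← reducedNorm_quaternionAlgebra_mul, Units.mul_inv, ← hr]
    simp [reducedNorm_quaternionAlgebra]

include h2 ha hb hker hϖ0 hgg in
/-- **`Γ ∩ g⁻¹ Γ g` is the stabiliser of a point of `ℙ¹(F)`**: with `w` a non-zero column of
`φ(ḡ)` (so that `F w = Im φ(ḡ) = ker φ(g)`), the subgroup `g⁻¹ Γ g ∩ Γ` of `Γ` is the preimage under
`ρ : Γ → GL₂(F)` of the stabiliser of `[w]` (the local computation `O_v^× ∩ g⁻¹ O_v^× g = Γ₀(v)`
of Vignéras II §2 Thm. 2.3, seen modulo `v`). [cite: VignerasLNM800, Ch. II §2 Thm. 2.3] -/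
theorem subgroupOf_conj_unitGroup_eq_comap_stabilizer {j : Fin 2}
    (hw : (redHom K a b s t hst ⟨star (g : ℍ⟮K; R; a, b⟯), star_mem_coordOrder hg⟩).col j ≠ 0) :
    (MulAut.conj g⁻¹ • unitGroup K a b).subgroupOf (unitGroup K a b) =
      (MulAction.stabilizer (GL (Fin 2) F) (Projectivization.mk F _ hw)).comap
        (redUnitsHom K a b s t hst) := by
  ext γ
  rw [Subgroup.mem_subgroupOf, Subgroup.mem_comap, MulAction.mem_stabilizer_iff,
    smul_mk_eq_self_iff, ← mul_mul_eq_zero_iff_exists_mulVec_col_eq_smul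
      (redHom_ne_zero_of_mul_star_eq hst h2 ha hb hker hϖ0 hg hgg)
      (redHom_mul_redHom_star_eq_zero hst hker hg hgg) hw,
    coe_redUnitsHom, ← conj_mem_unitGroup_iff hst h2 ha hb hker hϖ0 hg hgg, map_inv,
    Subgroup.mem_inv_pointwise_smul_iff, MulAut.smul_def, MulAut.conj_apply]

include hst hπ h2 ha hb hker hϖ0 hg hgg in
/-- **The index `[Γ : Γ ∩ g⁻¹ Γ g] = #F + 1`** under strong approximation modulo `𝔭` (orbit–stabiliser
on `ℙ¹(F)`, `#ℙ¹(F) = q + 1`; Shimura 1971 Prop. 3.1: this is the number of right cosets `Γ g γᵢ` in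
`Γ g Γ`; Vignéras II §2 Thm. 2.3 (3)). [cite: Shimura1971, Prop. 3.1] -/
theorem relIndex_conj_unitGroup_eq_of_normOne_lift [Finite F]
    (hSA : ∀ y ∈ coordOrder K a b,
      y * star y - 1 ∈ idealLattice K a b (RingHom.ker (algebraMap R F)) →
        ∃ u ∈ normOneGroup K a b,
          (u : ℍ⟮K; R; a, b⟯) - y ∈ idealLattice K a b (RingHom.ker (algebraMap R F))) :
    (MulAut.conj g⁻¹ • unitGroup K a b).relIndex (unitGroup K a b) = Nat.card F + 1 := by
  obtain ⟨j, hw⟩ := exists_col_ne_zero (redHom_star_ne_zero_of_mul_star_eq hst h2 ha hb hker hϖ0 hg hgg)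
  haveI := isPretransitive_range_redUnitsHom (K := K) hst hπ h2 ha hb hSA
  rw [Subgroup.relIndex, subgroupOf_conj_unitGroup_eq_comap_stabilizer hst h2 ha hb hker hϖ0 hg hgg hw,
    Subgroup.index_comap, Subgroup.relIndex, ← stabilizer_subgroup_eq_subgroupOf,
    MulAction.index_stabilizer_of_transitive,
    Projectivization.card_of_finrank_two F (Fin 2 → F) (Module.finrank_fin_fun F)]

include hg hgg in
/-- **`Γ g Γ ⊆ {x ∈ O : x x̄ ∈ R^× ϖ}`**: reduced norms multiply and `n(Γ) ⊆ R^×`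
(Vignéras I Lemme 4.12). [cite: VignerasLNM800, Ch. I §4 Lemme 4.12] -/
theorem doubleCoset_unitGroup_subset :
    DoubleCoset.doubleCoset g (unitGroup K a b : Set (ℍ⟮K; R; a, b⟯)ˣ)
        (unitGroup K a b : Set (ℍ⟮K; R; a, b⟯)ˣ) ⊆
      {x : (ℍ⟮K; R; a, b⟯)ˣ | (x : ℍ⟮K; R; a, b⟯) ∈ coordOrder K a b ∧
        ∃ ε : Rˣ, (x : ℍ⟮K; R; a, b⟯) * star (x : ℍ⟮K; R; a, b⟯) =
          algebraMap K ℍ⟮K; R; a, b⟯ (algebraMap R K ((ε : R) * ϖ))} := by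
  intro x hx
  obtain ⟨γ, hγ, γ', hγ', rfl⟩ := DoubleCoset.mem_doubleCoset.mp hx
  obtain ⟨hγO, r, hr⟩ := mem_unitGroup_iff_exists_reducedNorm_eq.mp hγ
  obtain ⟨hγ'O, r', hr'⟩ := mem_unitGroup_iff_exists_reducedNorm_eq.mp hγ'
  refine ⟨mul_mem (mul_mem hγO hg) hγ'O, r * r', ?_⟩
  rw [Units.val_mul, Units.val_mul, mul_star_self_eq_algebraMap_reducedNorm,
    reducedNorm_quaternionAlgebra_mul, reducedNorm_quaternionAlgebra_mul,
    reducedNorm_eq_of_mul_star_eq hgg, ← hr, ← hr']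
  congr 1
  rw [Units.val_mul, map_mul, map_mul]
  ring

include hst hπ h2 ha hb hker hϖ0 hg hgg in
/-- **`{x ∈ O : x x̄ ∈ R^× ϖ} ⊆ Γ g Γ`** under strong approximation modulo `𝔭`: for such `x`,
`φ(x)` is non-zero and singular, transitivity of `Γ` on `ℙ¹(F)` gives `γ ∈ Γ` with
`ρ(γ) · ker φ(ḡ) = Im φ(x)`, i.e. `ḡ γ⁻¹ x ∈ ϖ O`, and then `γ' := g⁻¹ γ⁻¹ x ∈ Γ`
(`n(γ') ∈ R^×`, Vignéras I Lemme 4.12) with `x = γ g γ'`. [cite: VignerasLNM800, Ch. I §4 Lemme 4.12] -/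
theorem subset_doubleCoset_unitGroup_of_normOne_lift
    (hSA : ∀ y ∈ coordOrder K a b,
      y * star y - 1 ∈ idealLattice K a b (RingHom.ker (algebraMap R F)) →
        ∃ u ∈ normOneGroup K a b,
          (u : ℍ⟮K; R; a, b⟯) - y ∈ idealLattice K a b (RingHom.ker (algebraMap R F))) :
    {x : (ℍ⟮K; R; a, b⟯)ˣ | (x : ℍ⟮K; R; a, b⟯) ∈ coordOrder K a b ∧
        ∃ ε : Rˣ, (x : ℍ⟮K; R; a, b⟯) * star (x : ℍ⟮K; R; a, b⟯) =
          algebraMap K ℍ⟮K; R; a, b⟯ (algebraMap R K ((ε : R) * ϖ))} ⊆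
      DoubleCoset.doubleCoset g (unitGroup K a b : Set (ℍ⟮K; R; a, b⟯)ˣ)
        (unitGroup K a b : Set (ℍ⟮K; R; a, b⟯)ˣ) := by
  rintro x ⟨hxO, ε, hxx⟩
  have hinj := FaithfulSMul.algebraMap_injective R K
  have hK : algebraMap R K ϖ ≠ 0 := fun h0 => hϖ0 (hinj (h0.trans (map_zero _).symm))
  have hϖu := not_isUnit_of_ker_eq (F := F) hker
  -- `A = φ(g) ≠ 0`, `C = φ(x) ≠ 0`, `D = φ(x̄) ≠ 0`, `D C = 0` (and `B A = 0` for `B = φ(ḡ)`)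
  have hA : redHom K a b s t hst ⟨g, hg⟩ ≠ 0 :=
    redHom_ne_zero_of_mul_star_eq hst h2 ha hb hker hϖ0 hg hgg
  have hC : redHom K a b s t hst ⟨x, hxO⟩ ≠ 0 := by
    rw [Ne, redHom_eq_zero_iff hst h2 ha hb hxO, hker]
    exact not_mem_idealLattice_span_singleton_of_mul_star_eq hϖu hϖ0 ε hxx
  have hD : redHom K a b s t hst ⟨star (x : ℍ⟮K; R; a, b⟯), star_mem_coordOrder hxO⟩ ≠ 0 := by
    rw [Ne, redHom_eq_zero_iff hst h2 ha hb (star_mem_coordOrder hxO), hker]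
    exact not_mem_idealLattice_span_singleton_of_mul_star_eq hϖu hϖ0 ε (star_mul_self_eq hxx)
  have hDC : redHom K a b s t hst ⟨star (x : ℍ⟮K; R; a, b⟯), star_mem_coordOrder hxO⟩ *
      redHom K a b s t hst ⟨x, hxO⟩ = 0 := by
    rw [← redHom_mul]
    have h : (⟨star (x : ℍ⟮K; R; a, b⟯) * (x : ℍ⟮K; R; a, b⟯),
        mul_mem (star_mem_coordOrder hxO) hxO⟩ : coordOrder K a b) =
        ⟨algebraMap K ℍ⟮K; R; a, b⟯ (algebraMap R K ((ε : R) * ϖ)),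
          hxx ▸ mul_mem hxO (star_mem_coordOrder hxO)⟩ :=
      Subtype.ext ((star_comm_self' (x : ℍ⟮K; R; a, b⟯)).trans hxx)
    rw [h, redHom_algebraMap, map_mul, algebraMap_eq_zero_of_ker_eq hker, mul_zero, map_zero]
  -- the two points `[w₁] = ker φ(ḡ)` (`w₁` a column of `φ(g)`) and `[w₂] = Im φ(x)` of `ℙ¹(F)`
  obtain ⟨j₁, hw₁⟩ := exists_col_ne_zero hA
  obtain ⟨j₂, hw₂⟩ := exists_col_ne_zero hC
  -- transitivity: `ρ(γ) [w₁] = [w₂]`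
  obtain ⟨γ, hγ⟩ := exists_redUnitsHom_smul_eq hst hπ h2 ha hb hSA
    (Projectivization.mk F _ hw₁) (Projectivization.mk F _ hw₂)
  rw [Projectivization.smul_mk, Projectivization.mk_eq_mk_iff] at hγ
  obtain ⟨c, hc⟩ := hγ
  -- hence `φ(ḡ) ρ(γ)⁻¹ φ(x) = 0`, i.e. `ḡ γ⁻¹ x ∈ ϖ O`
  have hBQC := mul_mul_eq_zero_of_smul_col_eq_mulVec_col
    (redHom_star_mul_redHom_eq_zero hst hker hg hgg) hD hDC hw₂
    (P := ((redUnitsHom K a b s t hst γ : GL (Fin 2) F) : Matrix (Fin 2) (Fin 2) F))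
    (Q := (((redUnitsHom K a b s t hst γ)⁻¹ : GL (Fin 2) F) : Matrix (Fin 2) (Fin 2) F))
    (by rw [← Units.val_mul, inv_mul_cancel, Units.val_one]) c.ne_zero
    (by rw [← Units.smul_def, hc]; rfl)
  rw [coe_redUnitsHom_inv, ← redHom_mul, ← redHom_mul, redHom_eq_zero_iff hst h2 ha hb, hker,
    mem_idealLattice_span_singleton_iff] at hBQC
  obtain ⟨z, hz, hz'⟩ := hBQC
  -- `γ' := g⁻¹ γ⁻¹ x` has `↑γ' = z ∈ O` and unit norm, so `γ' ∈ Γ` and `x = γ g γ'`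
  obtain ⟨rγ, hrγ⟩ := (mem_unitGroup_iff_exists_reducedNorm_eq.mp γ.2).2
  have hxy : x = (γ : (ℍ⟮K; R; a, b⟯)ˣ) * g * (g⁻¹ * (γ : (ℍ⟮K; R; a, b⟯)ˣ)⁻¹ * x) := by group
  have hyval : ((g⁻¹ * (γ : (ℍ⟮K; R; a, b⟯)ˣ)⁻¹ * x : (ℍ⟮K; R; a, b⟯)ˣ) : ℍ⟮K; R; a, b⟯) = z := by
    rw [Units.val_mul, Units.val_mul, units_inv_eq_smul_star hK hgg, smul_mul_assoc,
      smul_mul_assoc, hz', smul_smul, inv_mul_cancel₀ hK, one_smul]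
  refine DoubleCoset.mem_doubleCoset.mpr ⟨γ, γ.2, g⁻¹ * (γ : (ℍ⟮K; R; a, b⟯)ˣ)⁻¹ * x,
    mem_unitGroup_iff_exists_reducedNorm_eq.mpr ⟨hyval ▸ hz, ε * rγ⁻¹, ?_⟩, hxy⟩
  -- norms: `n(γ) n(g) n(γ') = n(x) = ε ϖ`, `n(γ) = rγ`, `n(g) = ϖ`
  have h := congrArg (fun u : (ℍ⟮K; R; a, b⟯)ˣ => reducedNorm K ℍ⟮K; R; a, b⟯ (u : ℍ⟮K; R; a, b⟯))
    hxy
  rw [Units.val_mul, Units.val_mul, reducedNorm_quaternionAlgebra_mul,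
    reducedNorm_quaternionAlgebra_mul, reducedNorm_eq_of_mul_star_eq hxx,
    reducedNorm_eq_of_mul_star_eq hgg, ← hrγ] at h
  have hu : algebraMap R K (rγ : R) * algebraMap R K ϖ ≠ 0 :=
    mul_ne_zero (rγ.isUnit.map (algebraMap R K)).ne_zero hK
  apply mul_left_cancel₀ hu
  rw [← h, ← map_mul, ← map_mul]
  congr 1
  rw [Units.val_mul]
  linear_combination ((ε : R) * ϖ) * rγ.mul_inv

include hst hπ h2 ha hb hker hϖ0 hg hgg in
/-- **`Γ g Γ = {x ∈ O : x x̄ ∈ R^× ϖ}`** for `Γ = O^×`, `g ∈ O`, `g ḡ = ϖ`, `(ϖ) = ker (R → F)`,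
under strong approximation modulo `𝔭` (both inclusions above). [cite: VignerasLNM800, Ch. II §2 Thm. 2.3 and Ch. III §4 Thm. 4.3] -/
theorem doubleCoset_unitGroup_eq_of_normOne_lift
    (hSA : ∀ y ∈ coordOrder K a b,
      y * star y - 1 ∈ idealLattice K a b (RingHom.ker (algebraMap R F)) →
        ∃ u ∈ normOneGroup K a b,
          (u : ℍ⟮K; R; a, b⟯) - y ∈ idealLattice K a b (RingHom.ker (algebraMap R F))) :
    DoubleCoset.doubleCoset g (unitGroup K a b : Set (ℍ⟮K; R; a, b⟯)ˣ)
        (unitGroup K a b : Set (ℍ⟮K; R; a, b⟯)ˣ) =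
      {x : (ℍ⟮K; R; a, b⟯)ˣ | (x : ℍ⟮K; R; a, b⟯) ∈ coordOrder K a b ∧
        ∃ ε : Rˣ, (x : ℍ⟮K; R; a, b⟯) * star (x : ℍ⟮K; R; a, b⟯) =
          algebraMap K ℍ⟮K; R; a, b⟯ (algebraMap R K ((ε : R) * ϖ))} :=
  Set.Subset.antisymm (doubleCoset_unitGroup_subset hg hgg)
    (subset_doubleCoset_unitGroup_of_normOne_lift hst hπ h2 ha hb hker hϖ0 hg hgg hSA)

end Hecke

/-! ### Existence of the splitting data over a finite field -/

section FiniteField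

variable {F : Type*} [Field F] [Finite F]

/-- Over a finite field of odd characteristic, `s² - α t² = β` is solvable for `α ≠ 0`
(Mathlib `FiniteField.exists_root_sum_quadratic`; Vignéras II §1 Lemme 1.10 works over the
residue field first). [cite: VignerasLNM800, Ch. II §1 Lemme 1.10] -/
theorem exists_sq_sub_mul_sq_eq (h2 : (2 : F) ≠ 0) {α : F} (hα : α ≠ 0) (β : F) :
    ∃ s t : F, s ^ 2 - α * t ^ 2 = β := by
  haveI := Fintype.ofFinite F
  have hchar : ringChar F ≠ 2 := fun h => h2 (by
    have := ringChar.Nat.cast_ringChar (R := F)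
    rw [h] at this
    exact_mod_cast this)
  have hdeg : (Polynomial.C (-α) * Polynomial.X ^ 2).degree = 2 := by
    rw [Polynomial.degree_C_mul_X_pow 2 (neg_ne_zero.mpr hα)]
    rfl
  obtain ⟨s, t, hst⟩ := FiniteField.exists_root_sum_quadratic
    (f := Polynomial.X ^ 2) (g := Polynomial.C (-α) * Polynomial.X ^ 2 - Polynomial.C β)
    (by rw [Polynomial.degree_X_pow]; rfl)
    (by rw [Polynomial.degree_sub_C (by rw [hdeg]; exact zero_lt_two), hdeg])
    (FiniteField.odd_card_of_char_ne_two hchar)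
  refine ⟨s, t, ?_⟩
  simp only [Polynomial.eval_pow, Polynomial.eval_X, Polynomial.eval_sub, Polynomial.eval_mul,
    Polynomial.eval_C] at hst
  linear_combination hst

end FiniteField

/-! ### The number-field statement -/

section NumberField

variable {K : Type} [Field K] [NumberField K]

/-- **Hecke double cosets of prime level for `Γ = O^×`, from strong approximation modulo `v`.**
For `a, b ∈ 𝓞 K`, a finite place `v = (ϖ)` with `v ∤ 2ab` and `g ∈ O` with `g ḡ = ϖ`: if every
`y ∈ O` with `y ȳ ≡ 1 (mod vO)` is congruent modulo `vO` to an element of `O¹` (the consequence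
modulo `v` of Kneser's strong approximation theorem, Vignéras III Thm. 4.3, for `ℍ[K,a,b]` not
totally definite), then `Γ g Γ = {x ∈ O : x x̄ ∈ (𝓞 K)^× ϖ}` and `[Γ : Γ ∩ g⁻¹ Γ g] = q_v + 1`
(Vignéras II §2 Thm. 2.3 globalised; Shimura 1971 Prop. 3.1). The hypotheses `a, b ≠ 0` and
"not totally definite" of the named fact are not needed for this implication.
[cite: VignerasLNM800, Ch. II §2 Thm. 2.3, Ch. III §4 Thm. 4.3] [cite: Shimura1971, Prop. 3.1] -/
theorem coordOrder_heckeDoubleCoset_of_normOne_lift (a b : 𝓞 K) (v : HeightOneSpectrum (𝓞 K))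
    (ϖ : 𝓞 K) (g : (ℍ⟮K; 𝓞 K; a, b⟯)ˣ) (hv : v.asIdeal = Ideal.span {ϖ})
    (h2ab : (2 * a * b : 𝓞 K) ∉ v.asIdeal) (hg : (g : ℍ⟮K; 𝓞 K; a, b⟯) ∈ coordOrder K a b)
    (hgg : (g : ℍ⟮K; 𝓞 K; a, b⟯) * star (g : ℍ⟮K; 𝓞 K; a, b⟯) =
      algebraMap K ℍ⟮K; 𝓞 K; a, b⟯ (ϖ : K))
    (hSA : ∀ y ∈ coordOrder K a b, y * star y - 1 ∈ idealLattice K a b v.asIdeal →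
      ∃ u ∈ normOneGroup K a b, (u : ℍ⟮K; 𝓞 K; a, b⟯) - y ∈ idealLattice K a b v.asIdeal) :
    DoubleCoset.doubleCoset g
        (unitGroup K a b : Set (ℍ⟮K; 𝓞 K; a, b⟯)ˣ)
        (unitGroup K a b : Set (ℍ⟮K; 𝓞 K; a, b⟯)ˣ) =
        {x : (ℍ⟮K; 𝓞 K; a, b⟯)ˣ |
          (x : ℍ⟮K; 𝓞 K; a, b⟯) ∈ coordOrder K a b ∧
          ∃ ε : (𝓞 K)ˣ, (x : ℍ⟮K; 𝓞 K; a, b⟯) *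
            star (x : ℍ⟮K; 𝓞 K; a, b⟯) =
            algebraMap K ℍ⟮K; 𝓞 K; a, b⟯ (((ε : 𝓞 K) * ϖ : 𝓞 K) : K)} ∧
      (MulAut.conj g⁻¹ • unitGroup K a b).relIndex (unitGroup K a b) = v.residueCard + 1 := by
  letI : Field (𝓞 K ⧸ v.asIdeal) := Ideal.Quotient.field v.asIdeal
  haveI : Finite (𝓞 K ⧸ v.asIdeal) :=
    (Ideal.absNorm_ne_zero_iff v.asIdeal).mp (Ideal.absNorm_eq_zero_iff.not.mpr v.ne_bot)
  have hker : RingHom.ker (algebraMap (𝓞 K) (𝓞 K ⧸ v.asIdeal)) = Ideal.span {ϖ} := by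
    rw [Ideal.Quotient.algebraMap_eq, Ideal.mk_ker, hv]
  have hπ : Function.Surjective (algebraMap (𝓞 K) (𝓞 K ⧸ v.asIdeal)) :=
    Ideal.Quotient.mk_surjective
  have hne : ∀ r : 𝓞 K, r ∉ v.asIdeal → algebraMap (𝓞 K) (𝓞 K ⧸ v.asIdeal) r ≠ 0 := fun r hr h =>
    hr ((Ideal.Quotient.eq_zero_iff_mem).mp h)
  have h2 : (2 : 𝓞 K ⧸ v.asIdeal) ≠ 0 := by
    rw [← map_ofNat (algebraMap (𝓞 K) (𝓞 K ⧸ v.asIdeal)) 2]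
    exact hne 2 fun h => h2ab (by simpa only [mul_assoc] using v.asIdeal.mul_mem_right (a * b) h)
  have ha : algebraMap (𝓞 K) (𝓞 K ⧸ v.asIdeal) a ≠ 0 :=
    hne a fun h => h2ab (by simpa only [mul_comm (2 * a) b, ← mul_assoc, mul_comm b 2]
      using v.asIdeal.mul_mem_left (2 * b) h)
  have hb : algebraMap (𝓞 K) (𝓞 K ⧸ v.asIdeal) b ≠ 0 :=
    hne b fun h => h2ab (v.asIdeal.mul_mem_left (2 * a) h)
  obtain ⟨s, t, hst⟩ := exists_sq_sub_mul_sq_eq h2 ha (algebraMap (𝓞 K) (𝓞 K ⧸ v.asIdeal) b)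
  have hϖ0 : ϖ ≠ 0 := fun h => v.ne_bot (by rw [hv, h, Ideal.span_singleton_eq_bot])
  have hgg' : (g : ℍ⟮K; 𝓞 K; a, b⟯) * star (g : ℍ⟮K; 𝓞 K; a, b⟯) =
      algebraMap K ℍ⟮K; 𝓞 K; a, b⟯ (algebraMap (𝓞 K) K ϖ) := hgg
  have hSA' : ∀ y ∈ coordOrder K a b, y * star y - 1 ∈
      idealLattice K a b (RingHom.ker (algebraMap (𝓞 K) (𝓞 K ⧸ v.asIdeal))) →
        ∃ u ∈ normOneGroup K a b, (u : ℍ⟮K; 𝓞 K; a, b⟯) - y ∈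
          idealLattice K a b (RingHom.ker (algebraMap (𝓞 K) (𝓞 K ⧸ v.asIdeal))) := by
    rw [hker, ← hv]
    exact hSA
  refine ⟨?_, ?_⟩
  · exact doubleCoset_unitGroup_eq_of_normOne_lift hst hπ h2 ha hb hker hϖ0 hg hgg' hSA'
  · rw [relIndex_conj_unitGroup_eq_of_normOne_lift hst hπ h2 ha hb hker hϖ0 hg hgg' hSA',
      v.residueCard_eq_card_quotient]

/-- **`coordOrder_heckeDoubleCoset` follows from strong approximation modulo every `v ∤ 2ab`**
for the norm-one groups of the coordinate orders of the non-totally-definite `ℍ[K,a,b]`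
(the consequence modulo `v` of Vignéras III Thm. 4.3, Kneser): the named fact is reduced to that
single input. [cite: VignerasLNM800, Ch. III §4 Thm. 4.3] [cite: Shimura1971, Prop. 3.1] -/
theorem coordOrder_heckeDoubleCoset_of_forall_normOne_lift
    (H : ∀ (K : Type) [Field K] [NumberField K] (a b : 𝓞 K), a ≠ 0 → b ≠ 0 →
      ¬ IsTotallyDefinite K ℍ⟮K; 𝓞 K; a, b⟯ →
      ∀ v : HeightOneSpectrum (𝓞 K), (2 * a * b : 𝓞 K) ∉ v.asIdeal →
        ∀ y ∈ coordOrder K a b, y * star y - 1 ∈ idealLattice K a b v.asIdeal →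
          ∃ u ∈ normOneGroup K a b, (u : ℍ⟮K; 𝓞 K; a, b⟯) - y ∈ idealLattice K a b v.asIdeal) :
    coordOrder_heckeDoubleCoset := by
  intro K _ _ a b ha hb hdef v ϖ g hv h2ab hg hgg
  exact coordOrder_heckeDoubleCoset_of_normOne_lift a b v ϖ g hv h2ab hg hgg
    (H K a b ha hb hdef v h2ab)

end NumberField

end QuaternionAlgebra

end Literature.NumberTheory.Automorphic
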